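import Mathlib
import Summits.Ventures.PercRepro2.Defs
import Summits.Ventures.PercRepro2.Independence
import Summits.Ventures.PercRepro2.Harris
import Summits.Ventures.PercRepro2.Graph
import Summits.Ventures.PercRepro2.Exploration
import Summits.Ventures.PercRepro2.Events
import Summits.Ventures.PercRepro2.Induced
import Summits.Ventures.PercRepro2.BHK
import Summits.Ventures.PercRepro2.BHKEvents
import Summits.Ventures.PercRepro2.OneEdge
import Summits.Ventures.PercRepro2.RBRoot
import Summits.Ventures.PercRepro2.RBRootEdge
import Summits.Ventures.PercRepro2.RBRootEdgePin

/-!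
# Row 2′RB: the root edges at the third vertex can be removed (mine-a g5; MINE-A.md §31)

For an edge `e = {w, s}` between the third vertex `w` and the root `s`, the row at `w` for the
weights `p` follows from the row at `w` for `p[e ↦ 0]` (`e` deleted) — `same_of_update`,
`cross_of_update`:
* the Rao–Blackwell sum is affine in `p e` (`RBRootEdgePin`);
* under `p[e ↦ 1]` the cluster of `w` is the cluster of `s`, so that part is the row at the ROOT
  `s` (`RBRoot.same_at_s` / `cross_at_s`);
* the remaining 2-point mixture inequality (`mix_same` / `mix_cross`) is the sign of
  `(μ₁(bL) − μ₀(bL)) · (μ₁(oL) − μ₀(oL))` resp. `(μ₁(bL) − μ₀(bL)) · (μ₁(oH) − μ₀(oH))`, `μ₁` =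
  the law with `e` forced open = `μ₀` conditioned on `{w ↮ t}` with `{b ↔ s}` enlarged by
  `{b ↔ w}`: BHK 1.5 (`bhk_cross_cluster` at `(b, w)`, `mono_root`) and BHK 1.3 for the cluster
  of `t` (`bhk_same_cluster_events`, `mono_other`) sign the two factors.
Iterating over every edge between `w` and the roots (the mirror edge `{w, t}` is the same
argument with the roots renamed for the mirrored forms): 2′RB is equivalent to its restriction
to third vertices with no edge to a root.
-/

namespace Summit.Ventures.PercRepro2

namespace RBRootEdge

open scoped Classical

section Forced

variable {V : Type*} {E : Type*} [Fintype E] [DecidableEq E] [Fintype V] {R : Type*} [Field R]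
  [LinearOrder R] [IsStrictOrderedRing R] (p : E → R) (ends : E → Sym2 V) (s t w : V) {e : E}

omit [Fintype V] [LinearOrder R] [IsStrictOrderedRing R] in
/-- Under `p[e ↦ 1]` (`e = {w, s}` forced open) the cluster of `w` is the cluster of `s`. -/
lemma prob_update_one_atom_eq (hends : ends e = s(w, s)) (Z : Set (Config E)) (A : Set V) :
    prob (Function.update p e 1) (Z ∩ clusterEvent ends w A) =
      prob (Function.update p e 1) (Z ∩ clusterEvent ends s A) := by
  rw [← prob_update_one_inter_openEdge p (Z ∩ clusterEvent ends w A) e,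
    ← prob_update_one_inter_openEdge p (Z ∩ clusterEvent ends s A) e]
  congr 1
  ext ω
  simp only [Set.mem_inter_iff, mem_clusterEvent, mem_openEdge]
  constructor
  · rintro ⟨⟨hZ, hC⟩, he⟩
    refine ⟨⟨hZ, ?_⟩, he⟩
    rw [cluster_eq_of_mem ends (show s ∈ cluster ends ω w from conn_of_openAdj ⟨e, he, hends⟩), hC]
  · rintro ⟨⟨hZ, hC⟩, he⟩
    refine ⟨⟨hZ, ?_⟩, he⟩
    rw [cluster_eq_of_mem ends (show w ∈ cluster ends ω s from
      conn_symm (conn_of_openAdj ⟨e, he, hends⟩)), hC]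

omit [LinearOrder R] [IsStrictOrderedRing R] in
/-- Under `p[e ↦ 1]` the Rao–Blackwell sum at `w` is the Rao–Blackwell sum at the root `s`. -/
lemma rbSum_update_one_eq (hends : ends e = s(w, s)) (X Y : Set (Config E)) :
    RBRoot.rbSum (Function.update p e 1) ends s t w X Y =
      RBRoot.rbSum (Function.update p e 1) ends s t s X Y := by
  unfold RBRoot.rbSum
  refine Finset.sum_congr rfl fun A _ => ?_
  rw [Set.inter_right_comm _ (clusterEvent ends w A) X, Set.inter_right_comm _ (clusterEvent ends w A) Y,
    prob_update_one_atom_eq p ends s w hends _ A, prob_update_one_atom_eq p ends s w hends _ A,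
    prob_update_one_atom_eq p ends s w hends _ A,
    ← Set.inter_right_comm _ (clusterEvent ends s A) X,
    ← Set.inter_right_comm _ (clusterEvent ends s A) Y]

variable {p}

omit [Fintype V] [LinearOrder R] [IsStrictOrderedRing R] in
/-- `P_{p[e↦1]}(Q) = P_{p[e↦0]}(Q ∩ {w ↮ t})` (`e = {w, s}`). -/
lemma prob_update_one_compl (hends : ends e = s(w, s)) :
    prob (Function.update p e 1) (connEvent ends s t)ᶜ =
      prob (Function.update p e 0) ((connEvent ends s t)ᶜ ∩ (connEvent ends w t)ᶜ) := by
  rw [← update_zero_update_one p e, prob_update_one_eq]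
  congr 1
  ext ω
  simp only [Set.mem_setOf_eq, Set.mem_inter_iff]
  exact force_mem_compl_connEvent hends ω

omit [Fintype V] in
/-- `P_{p[e↦1]}(Q ∩ {b ↔ s}) ≥ P_{p[e↦0]}(Q ∩ {b ↔ s} ∩ {w ↮ t})` (`e = {w, s}`). -/
lemma prob_update_one_conn_root_ge (hp : IsProbVec p) (hends : ends e = s(w, s)) (b : V) :
    prob (Function.update p e 0) ((connEvent ends s t)ᶜ ∩ connEvent ends b s ∩
        (connEvent ends w t)ᶜ) ≤
      prob (Function.update p e 1) ((connEvent ends s t)ᶜ ∩ connEvent ends b s) := by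
  rw [← update_zero_update_one p e, prob_update_one_eq]
  refine prob_mono (hp.update e le_rfl zero_le_one) fun ω hω => ?_
  simp only [Set.mem_setOf_eq, Set.mem_inter_iff]
  exact ⟨(force_mem_compl_connEvent hends ω).2 ⟨hω.1.1, hω.2⟩,
    (force_mem_connEvent_root hends ω).2 (Or.inl hω.1.2)⟩

omit [Fintype V] [LinearOrder R] [IsStrictOrderedRing R] in
/-- `P_{p[e↦1]}(Q ∩ {o ↔ t}) = P_{p[e↦0]}(Q ∩ {o ↔ t} ∩ {w ↮ t})` (`e = {w, s}`). -/
lemma prob_update_one_conn_other (hends : ends e = s(w, s)) (o : V) :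
    prob (Function.update p e 1) ((connEvent ends s t)ᶜ ∩ connEvent ends o t) =
      prob (Function.update p e 0) ((connEvent ends s t)ᶜ ∩ connEvent ends o t ∩
        (connEvent ends w t)ᶜ) := by
  rw [← update_zero_update_one p e, prob_update_one_eq]
  congr 1
  ext ω
  simp only [Set.mem_setOf_eq, Set.mem_inter_iff]
  constructor
  · rintro ⟨hQ, ho⟩
    have hQ' := (force_mem_compl_connEvent hends ω).1 hQ
    exact ⟨⟨hQ'.1, (force_mem_connEvent_other hends ω hQ'.1 hQ'.2).1 ho⟩, hQ'.2⟩
  · rintro ⟨⟨hQ, ho⟩, hw⟩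
    exact ⟨(force_mem_compl_connEvent hends ω).2 ⟨hQ, hw⟩,
      (force_mem_connEvent_other hends ω hQ hw).2 ho⟩

/-- **Monotonicity of the root side**: `μ₁(b ↔ s) ≥ μ₀(b ↔ s)` in the cleared form
`P₀(Q ∩ bL) · P₁(Q) ≤ P₁(Q ∩ bL) · P₀(Q)` — BHK 1.5 (`bhk_cross_cluster` at `(b, w)`). -/
lemma mono_root (hp : IsProbVec p) (hends : ends e = s(w, s)) (b : V) :
    prob (Function.update p e 0) ((connEvent ends s t)ᶜ ∩ connEvent ends b s) *
        prob (Function.update p e 1) (connEvent ends s t)ᶜ ≤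
      prob (Function.update p e 1) ((connEvent ends s t)ᶜ ∩ connEvent ends b s) *
        prob (Function.update p e 0) (connEvent ends s t)ᶜ := by
  have hp0 : IsProbVec (Function.update p e 0) := hp.update e le_rfl zero_le_one
  have key := bhk_cross_cluster (Function.update p e 0) hp0 ends s t (RBRoot.isUpperSet_mem b)
    (RBRoot.isUpperSet_mem w)
  rw [← RBRoot.connEvent_eq_clusterInEvent_right ends b s,
    ← RBRoot.connEvent_eq_clusterInEvent_right ends w t] at key
  rw [prob_update_one_compl ends s t w hends]
  have h1 := prob_update_one_conn_root_ge ends s t w hp hends b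
  have dA := prob_inter_add_prob_inter_compl (Function.update p e 0)
    ((connEvent ends s t)ᶜ ∩ connEvent ends b s) (connEvent ends w t)
  have dZ := prob_inter_add_prob_inter_compl (Function.update p e 0) (connEvent ends s t)ᶜ
    (connEvent ends w t)
  have e1 : connEvent ends b s ∩ connEvent ends w t ∩ (connEvent ends s t)ᶜ =
      (connEvent ends s t)ᶜ ∩ connEvent ends b s ∩ connEvent ends w t := by
    ext ω; simp only [Set.mem_inter_iff]; tauto
  have e2 : connEvent ends b s ∩ (connEvent ends s t)ᶜ =
      (connEvent ends s t)ᶜ ∩ connEvent ends b s := Set.inter_comm _ _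
  have e3 : connEvent ends w t ∩ (connEvent ends s t)ᶜ =
      (connEvent ends s t)ᶜ ∩ connEvent ends w t := Set.inter_comm _ _
  rw [e1, e2, e3] at key
  have hZ : 0 ≤ prob (Function.update p e 0) (connEvent ends s t)ᶜ := prob_nonneg hp0 _
  have h2 := mul_le_mul_of_nonneg_right h1 hZ
  have hA' : prob (Function.update p e 0) ((connEvent ends s t)ᶜ ∩ connEvent ends b s ∩
      (connEvent ends w t)ᶜ) * prob (Function.update p e 0) (connEvent ends s t)ᶜ =
      prob (Function.update p e 0) ((connEvent ends s t)ᶜ ∩ connEvent ends b s) *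
        prob (Function.update p e 0) (connEvent ends s t)ᶜ -
      prob (Function.update p e 0) ((connEvent ends s t)ᶜ ∩ connEvent ends b s ∩ connEvent ends w t) *
        prob (Function.update p e 0) (connEvent ends s t)ᶜ := by
    rw [← dA]; ring
  have hZ' : prob (Function.update p e 0) ((connEvent ends s t)ᶜ ∩ connEvent ends b s) *
      prob (Function.update p e 0) ((connEvent ends s t)ᶜ ∩ (connEvent ends w t)ᶜ) =
      prob (Function.update p e 0) ((connEvent ends s t)ᶜ ∩ connEvent ends b s) *
        prob (Function.update p e 0) (connEvent ends s t)ᶜ -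
      prob (Function.update p e 0) ((connEvent ends s t)ᶜ ∩ connEvent ends b s) *
        prob (Function.update p e 0) ((connEvent ends s t)ᶜ ∩ connEvent ends w t) := by
    rw [← dZ]; ring
  linarith [key, h2, hA', hZ']

/-- **Monotonicity of the other side**: `μ₁(o ↔ t) ≤ μ₀(o ↔ t)` in the cleared form
`P₁(Q ∩ oH) · P₀(Q) ≤ P₀(Q ∩ oH) · P₁(Q)` — BHK 1.3 for the cluster of `t`. -/
lemma mono_other (hp : IsProbVec p) (hends : ends e = s(w, s)) (o : V) :
    prob (Function.update p e 1) ((connEvent ends s t)ᶜ ∩ connEvent ends o t) *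
        prob (Function.update p e 0) (connEvent ends s t)ᶜ ≤
      prob (Function.update p e 0) ((connEvent ends s t)ᶜ ∩ connEvent ends o t) *
        prob (Function.update p e 1) (connEvent ends s t)ᶜ := by
  have hp0 : IsProbVec (Function.update p e 0) := hp.update e le_rfl zero_le_one
  have key := bhk_same_cluster_events (Function.update p e 0) hp0 ends t s
    (RBRoot.isUpperSet_mem o) (RBRoot.isUpperSet_mem w)
  rw [← RBRoot.connEvent_eq_clusterInEvent_right ends o t,
    ← RBRoot.connEvent_eq_clusterInEvent_right ends w t, ← RBRoot.compl_connEvent_comm] at key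
  rw [prob_update_one_compl ends s t w hends, prob_update_one_conn_other ends s t w hends o]
  have dC := prob_inter_add_prob_inter_compl (Function.update p e 0)
    ((connEvent ends s t)ᶜ ∩ connEvent ends o t) (connEvent ends w t)
  have dZ := prob_inter_add_prob_inter_compl (Function.update p e 0) (connEvent ends s t)ᶜ
    (connEvent ends w t)
  have e1 : connEvent ends o t ∩ connEvent ends w t ∩ (connEvent ends s t)ᶜ =
      (connEvent ends s t)ᶜ ∩ connEvent ends o t ∩ connEvent ends w t := by
    ext ω; simp only [Set.mem_inter_iff]; tauto
  have e2 : connEvent ends o t ∩ (connEvent ends s t)ᶜ =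
      (connEvent ends s t)ᶜ ∩ connEvent ends o t := Set.inter_comm _ _
  have e3 : connEvent ends w t ∩ (connEvent ends s t)ᶜ =
      (connEvent ends s t)ᶜ ∩ connEvent ends w t := Set.inter_comm _ _
  rw [e1, e2, e3] at key
  have hC' : prob (Function.update p e 0) ((connEvent ends s t)ᶜ ∩ connEvent ends o t ∩
      (connEvent ends w t)ᶜ) * prob (Function.update p e 0) (connEvent ends s t)ᶜ =
      prob (Function.update p e 0) ((connEvent ends s t)ᶜ ∩ connEvent ends o t) *
        prob (Function.update p e 0) (connEvent ends s t)ᶜ -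
      prob (Function.update p e 0) ((connEvent ends s t)ᶜ ∩ connEvent ends o t ∩ connEvent ends w t) *
        prob (Function.update p e 0) (connEvent ends s t)ᶜ := by
    rw [← dC]; ring
  have hZ' : prob (Function.update p e 0) ((connEvent ends s t)ᶜ ∩ connEvent ends o t) *
      prob (Function.update p e 0) ((connEvent ends s t)ᶜ ∩ (connEvent ends w t)ᶜ) =
      prob (Function.update p e 0) ((connEvent ends s t)ᶜ ∩ connEvent ends o t) *
        prob (Function.update p e 0) (connEvent ends s t)ᶜ -
      prob (Function.update p e 0) ((connEvent ends s t)ᶜ ∩ connEvent ends o t) *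
        prob (Function.update p e 0) ((connEvent ends s t)ᶜ ∩ connEvent ends w t) := by
    rw [← dZ]; ring
  linarith [key, hC', hZ']

end Forced

section Mixture

variable {R : Type*} [Field R] [LinearOrder R] [IsStrictOrderedRing R]

/-- **The 2-point mixture inequality, same version**: with `0 ≤ aᵢ ≤ zᵢ`, `0 ≤ bᵢ ≤ zᵢ` and
`(a₁z₀ − a₀z₁)(b₁z₀ − b₀z₁) ≥ 0`,
`(qa₁+(1−q)a₀)(qb₁+(1−q)b₀)/(qz₁+(1−q)z₀) ≤ q·a₁b₁/z₁ + (1−q)·a₀b₀/z₀`. -/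
lemma mix_same {q a0 a1 b0 b1 z0 z1 : R} (hq0 : 0 ≤ q) (hq1 : q ≤ 1) (ha0 : 0 ≤ a0)
    (ha0z : a0 ≤ z0) (ha1 : 0 ≤ a1) (ha1z : a1 ≤ z1) (hb0 : 0 ≤ b0) (hb0z : b0 ≤ z0)
    (hb1 : 0 ≤ b1) (hb1z : b1 ≤ z1) (hAB : 0 ≤ (a1 * z0 - a0 * z1) * (b1 * z0 - b0 * z1)) :
    (q * a1 + (1 - q) * a0) * (q * b1 + (1 - q) * b0) / (q * z1 + (1 - q) * z0) ≤
      q * (a1 * b1 / z1) + (1 - q) * (a0 * b0 / z0) := by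
  have hq1' : 0 ≤ 1 - q := sub_nonneg.2 hq1
  rcases eq_or_lt_of_le (ha1.trans ha1z) with hz1 | hz1
  · -- `z₁ = 0`: `a₁ = b₁ = 0`
    have ha1' : a1 = 0 := le_antisymm (hz1 ▸ ha1z) ha1
    have hb1' : b1 = 0 := le_antisymm (hz1 ▸ hb1z) hb1
    rw [← hz1, ha1', hb1']
    simp only [mul_zero, zero_add, div_zero]
    rcases eq_or_lt_of_le hq1' with hq | hq
    · rw [← hq]
      simp
    · rcases eq_or_lt_of_le (ha0.trans ha0z) with hz0 | hz0
      · rw [← hz0, mul_zero, div_zero, div_zero, mul_zero]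
      · rw [show (1 - q) * a0 * ((1 - q) * b0) / ((1 - q) * z0) = (1 - q) * (a0 * b0 / z0) by
          field_simp]
  rcases eq_or_lt_of_le (ha0.trans ha0z) with hz0 | hz0
  · -- `z₀ = 0`: `a₀ = b₀ = 0`
    have ha0' : a0 = 0 := le_antisymm (hz0 ▸ ha0z) ha0
    have hb0' : b0 = 0 := le_antisymm (hz0 ▸ hb0z) hb0
    rw [← hz0, ha0', hb0']
    simp only [mul_zero, add_zero, div_zero]
    rcases eq_or_lt_of_le hq0 with hq | hq
    · rw [← hq]
      simp
    · rw [show q * a1 * (q * b1) / (q * z1) = q * (a1 * b1 / z1) by field_simp]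
  -- both denominators positive
  have hZ : 0 < q * z1 + (1 - q) * z0 := by
    rcases eq_or_lt_of_le hq0 with hq | hq
    · rw [← hq]; simpa using hz0
    · positivity
  rw [← mul_div_assoc, ← mul_div_assoc, div_add_div _ _ hz1.ne' hz0.ne',
    div_le_div_iff₀ hZ (mul_pos hz1 hz0)]
  nlinarith [mul_nonneg (mul_nonneg hq0 hq1') hAB]

/-- **The 2-point mixture inequality, cross version**: with `(a₁z₀ − a₀z₁)(c₁z₀ − c₀z₁) ≤ 0`,
`q·a₁c₁/z₁ + (1−q)·a₀c₀/z₀ ≤ (qa₁+(1−q)a₀)(qc₁+(1−q)c₀)/(qz₁+(1−q)z₀)`. -/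
lemma mix_cross {q a0 a1 c0 c1 z0 z1 : R} (hq0 : 0 ≤ q) (hq1 : q ≤ 1) (ha0 : 0 ≤ a0)
    (ha0z : a0 ≤ z0) (ha1 : 0 ≤ a1) (ha1z : a1 ≤ z1) (hc0 : 0 ≤ c0) (hc0z : c0 ≤ z0)
    (hc1 : 0 ≤ c1) (hc1z : c1 ≤ z1) (hAC : (a1 * z0 - a0 * z1) * (c1 * z0 - c0 * z1) ≤ 0) :
    q * (a1 * c1 / z1) + (1 - q) * (a0 * c0 / z0) ≤
      (q * a1 + (1 - q) * a0) * (q * c1 + (1 - q) * c0) / (q * z1 + (1 - q) * z0) := by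
  have hq1' : 0 ≤ 1 - q := sub_nonneg.2 hq1
  rcases eq_or_lt_of_le (ha1.trans ha1z) with hz1 | hz1
  · have ha1' : a1 = 0 := le_antisymm (hz1 ▸ ha1z) ha1
    have hc1' : c1 = 0 := le_antisymm (hz1 ▸ hc1z) hc1
    rw [← hz1, ha1', hc1']
    simp only [mul_zero, zero_add, div_zero]
    rcases eq_or_lt_of_le hq1' with hq | hq
    · rw [← hq]
      simp
    · rcases eq_or_lt_of_le (ha0.trans ha0z) with hz0 | hz0
      · rw [← hz0, mul_zero, div_zero, div_zero, mul_zero]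
      · rw [show (1 - q) * a0 * ((1 - q) * c0) / ((1 - q) * z0) = (1 - q) * (a0 * c0 / z0) by
          field_simp]
  rcases eq_or_lt_of_le (ha0.trans ha0z) with hz0 | hz0
  · have ha0' : a0 = 0 := le_antisymm (hz0 ▸ ha0z) ha0
    have hc0' : c0 = 0 := le_antisymm (hz0 ▸ hc0z) hc0
    rw [← hz0, ha0', hc0']
    simp only [mul_zero, add_zero, div_zero]
    rcases eq_or_lt_of_le hq0 with hq | hq
    · rw [← hq]
      simp
    · rw [show q * a1 * (q * c1) / (q * z1) = q * (a1 * c1 / z1) by field_simp]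
  have hZ : 0 < q * z1 + (1 - q) * z0 := by
    rcases eq_or_lt_of_le hq0 with hq | hq
    · rw [← hq]; simpa using hz0
    · positivity
  rw [← mul_div_assoc, ← mul_div_assoc, div_add_div _ _ hz1.ne' hz0.ne',
    div_le_div_iff₀ (mul_pos hz1 hz0) hZ]
  nlinarith [mul_nonneg (mul_nonneg hq0 hq1') (neg_nonneg.2 hAC)]

end Mixture

section Main

variable {V : Type*} {E : Type*} [Fintype E] [DecidableEq E] [Fintype V] {R : Type*} [Field R]
  [LinearOrder R] [IsStrictOrderedRing R] (ends : E → Sym2 V) {p : E → R} {e : E}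

/-- **Root edges at the third vertex can be removed — (RB-same).** For `e = {w, s}`, the same
form of the row at `w` under `p` follows from the same form under `p[e ↦ 0]`. -/
theorem same_of_update (hp : IsProbVec p) {s t w o b : V} (hends : ends e = s(w, s))
    (h0 : prob (Function.update p e 0) ((connEvent ends s t)ᶜ ∩ connEvent ends b s) *
        prob (Function.update p e 0) ((connEvent ends s t)ᶜ ∩ connEvent ends o s) /
        prob (Function.update p e 0) (connEvent ends s t)ᶜ ≤
      RBRoot.rbSum (Function.update p e 0) ends s t w (connEvent ends b s) (connEvent ends o s)) :
    prob p ((connEvent ends s t)ᶜ ∩ connEvent ends b s) *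
        prob p ((connEvent ends s t)ᶜ ∩ connEvent ends o s) / prob p (connEvent ends s t)ᶜ ≤
      RBRoot.rbSum p ends s t w (connEvent ends b s) (connEvent ends o s) := by
  have hp0 : IsProbVec (Function.update p e 0) := hp.update e le_rfl zero_le_one
  have hp1 : IsProbVec (Function.update p e 1) := hp.update e zero_le_one le_rfl
  have h1 : prob (Function.update p e 1) ((connEvent ends s t)ᶜ ∩ connEvent ends b s) *
      prob (Function.update p e 1) ((connEvent ends s t)ᶜ ∩ connEvent ends o s) /
      prob (Function.update p e 1) (connEvent ends s t)ᶜ ≤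
      RBRoot.rbSum (Function.update p e 1) ends s t w (connEvent ends b s) (connEvent ends o s) := by
    rw [rbSum_update_one_eq p ends s t w hends]
    exact RBRoot.same_at_s ends hp1 o b s t
  rw [rbSum_pin_same ends s t w hp hends o b, prob_eq_pin p ((connEvent ends s t)ᶜ ∩ connEvent ends b s) e,
    prob_eq_pin p ((connEvent ends s t)ᶜ ∩ connEvent ends o s) e, prob_eq_pin p (connEvent ends s t)ᶜ e]
  have hmix := mix_same (hp.nonneg e) (hp.le_one e) (prob_nonneg hp0 _)
    (prob_mono hp0 Set.inter_subset_left) (prob_nonneg hp1 _) (prob_mono hp1 Set.inter_subset_left)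
    (prob_nonneg hp0 _) (prob_mono hp0 Set.inter_subset_left) (prob_nonneg hp1 _)
    (prob_mono hp1 Set.inter_subset_left)
    (mul_nonneg (sub_nonneg.2 (mono_root ends s t w hp hends b))
      (sub_nonneg.2 (mono_root ends s t w hp hends o)))
  exact hmix.trans (add_le_add (mul_le_mul_of_nonneg_left h1 (hp.nonneg e))
    (mul_le_mul_of_nonneg_left h0 (sub_nonneg.2 (hp.le_one e))))

/-- **Root edges at the third vertex can be removed — (RB-cross).** For `e = {w, s}`, the cross
form of the row at `w` under `p` follows from the cross form under `p[e ↦ 0]`. -/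
theorem cross_of_update (hp : IsProbVec p) {s t w o b : V} (hends : ends e = s(w, s))
    (h0 : RBRoot.rbSum (Function.update p e 0) ends s t w (connEvent ends b s) (connEvent ends o t) ≤
      prob (Function.update p e 0) ((connEvent ends s t)ᶜ ∩ connEvent ends b s) *
        prob (Function.update p e 0) ((connEvent ends s t)ᶜ ∩ connEvent ends o t) /
        prob (Function.update p e 0) (connEvent ends s t)ᶜ) :
    RBRoot.rbSum p ends s t w (connEvent ends b s) (connEvent ends o t) ≤
      prob p ((connEvent ends s t)ᶜ ∩ connEvent ends b s) *
        prob p ((connEvent ends s t)ᶜ ∩ connEvent ends o t) / prob p (connEvent ends s t)ᶜ := by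
  have hp0 : IsProbVec (Function.update p e 0) := hp.update e le_rfl zero_le_one
  have hp1 : IsProbVec (Function.update p e 1) := hp.update e zero_le_one le_rfl
  have h1 : RBRoot.rbSum (Function.update p e 1) ends s t w (connEvent ends b s) (connEvent ends o t) ≤
      prob (Function.update p e 1) ((connEvent ends s t)ᶜ ∩ connEvent ends b s) *
        prob (Function.update p e 1) ((connEvent ends s t)ᶜ ∩ connEvent ends o t) /
        prob (Function.update p e 1) (connEvent ends s t)ᶜ := by
    rw [rbSum_update_one_eq p ends s t w hends]
    exact RBRoot.cross_at_s ends hp1 o b s t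
  rw [rbSum_pin_cross ends s t w hp hends o b, prob_eq_pin p ((connEvent ends s t)ᶜ ∩ connEvent ends b s) e,
    prob_eq_pin p ((connEvent ends s t)ᶜ ∩ connEvent ends o t) e, prob_eq_pin p (connEvent ends s t)ᶜ e]
  have hmix := mix_cross (hp.nonneg e) (hp.le_one e) (prob_nonneg hp0 _)
    (prob_mono hp0 Set.inter_subset_left) (prob_nonneg hp1 _) (prob_mono hp1 Set.inter_subset_left)
    (prob_nonneg hp0 _) (prob_mono hp0 Set.inter_subset_left) (prob_nonneg hp1 _)
    (prob_mono hp1 Set.inter_subset_left)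
    (mul_nonpos_of_nonneg_of_nonpos (sub_nonneg.2 (mono_root ends s t w hp hends b))
      (sub_nonpos.2 (mono_other ends s t w hp hends o)))
  exact (add_le_add (mul_le_mul_of_nonneg_left h1 (hp.nonneg e))
    (mul_le_mul_of_nonneg_left h0 (sub_nonneg.2 (hp.le_one e)))).trans hmix

end Main


end RBRootEdge

end Summit.Ventures.PercRepro2
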